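import Mathlib
import Literature.Analysis.FluidPDE.GalerkinFlow
import HarnessLib

/-!
# Stub `stub_energy_hasDerivAt` of line `Sketch` — crux `WazewskiBlock.UniformGalerkinTrap`
# (stmt-AnomalousDissipation-10352)

Sorry-free discharge of the registered stub `stub_energy_hasDerivAt` of the lead's skeleton
(`Cruxes/UniformGalerkinTrap/Lines/Sketch.lean`): the **energy face derivative** along the
Galerkin phase semiflow `galerkinPhaseFlow ν ĝ` (`ĝ = fourierRestrict (freqBall N) f`) on the
phase space `X = ↥(galerkinSubspace (freqBall N))` of real divergence-free coefficient vectors —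
the energy identity of the Galerkin system in differential form, at every `t > 0`:

  `d/dt ½ ∑ₖ ‖c k‖² = ∑ₖ Re ⟪ĝ k, c k⟫ − ν · 4π² ∑ₖ |k|² ‖c k‖²`,

`c = galerkinPhaseFlow ν ĝ · x` (the nonlinear term drops out by transversality/antisymmetry).

**Proof.** The orbit `s ↦ ↑(galerkinPhaseFlow ν ĝ s x) = galerkinCoeffFlow ν ĝ s ↑x` is a global
solution of the Galerkin ODE (`isGalerkinODESolution_galerkinCoeffFlow`, with `ν ≥ 0`, the ball
symmetric, `ĝ` real since `f ∈ L² ⊆ L¹`, and `↑x ∈ galerkinSubspace`), hence differentiable at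
`t > 0` with derivative `galerkinRHS _ ν ĝ (c t)` (`IsGalerkinODESolution.hasDerivAt`). The tree's
`hasDerivWithinAt_energy` (Robinson–Rodrigo–Sadowski 2016, (4.6)–(4.7)) gives
`d/dt ∑‖c k‖² = 2 (−ν ‖∇u‖² + ∫⟪G, u⟫)` with `u = realTrigPoly S c̄`, `G = realTrigPoly S ḡ`;
the dictionary `toReal_eGradNormSq_realTrigPoly` / `integral_inner_realTrigPoly_realTrigPoly`
(Parseval on the symmetric ball) converts the two field quantities to the coefficient sums, and
the factor `½` is `HasDerivAt.const_mul`.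

References: J. C. Robinson, J. L. Rodrigo, W. Sadowski, *The three-dimensional Navier–Stokes
equations*, CUP 2016, §4.1, Thm. 4.4 Step 2, (4.6)–(4.7); P. Constantin, C. Foias,
*Navier–Stokes Equations*, Chicago 1988, Ch. 8, (8.7).
-/

noncomputable section
-- `Summit.<Summit>.<Problem>` is the tree's mandated summit-side namespace (CONVENTIONS §2); deliberate duplicate.
set_option linter.dupNamespace false
namespace Summit.AnomalousDissipation.AnomalousDissipation.Theorems.UniformGalerkinTrap.Sketch
open MeasureTheory Set Filter Topology
open scoped ENNReal NNReal InnerProductSpace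
open Literature.Analysis.FunctionSpaces Literature.Analysis.FunctionSpaces.Torus
open Literature.Analysis.FluidPDE

/-- **The energy face derivative along the Galerkin phase flow** (energy identity in differential
form; Robinson–Rodrigo–Sadowski 2016, Thm. 4.4 Step 2, (4.6)–(4.7)). For `ν ≥ 0`, `f ∈ L²`, a
phase point `x` and `t > 0`, with `ĝ = fourierRestrict (freqBall N) f` and
`c s = galerkinPhaseFlow ν ĝ s x`:
`d/dt ½ ∑ₖ ‖c k‖² |ₜ = ∑ₖ Re ⟪ĝ k, c t k⟫ − ν · (4π² ∑ₖ |k|² ‖c t k‖²)`. [folklore] -/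
theorem stub_energy_hasDerivAt :
    ∀ (ν : ℝ) (N : ℕ) (f : UnitAddTorus (Fin 3) → EuclideanSpace ℝ (Fin 3))
      (x : ↥(galerkinSubspace (freqBall N : Finset (Fin 3 → ℤ)))) (t : ℝ),
      0 ≤ ν → MemLp f 2 volume → 0 < t →
      HasDerivAt
        (fun s => 2⁻¹ * ∑ k, ‖(galerkinPhaseFlow ν (fourierRestrict (freqBall N : Finset (Fin 3 → ℤ)) f) s x :
            ↥(freqBall N : Finset (Fin 3 → ℤ)) → EuclideanSpace ℂ (Fin 3)) k‖ ^ 2)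
        ((∑ k, (inner ℂ (fourierRestrict (freqBall N : Finset (Fin 3 → ℤ)) f k)
            ((galerkinPhaseFlow ν (fourierRestrict (freqBall N : Finset (Fin 3 → ℤ)) f) t x :
              ↥(freqBall N : Finset (Fin 3 → ℤ)) → EuclideanSpace ℂ (Fin 3)) k)).re) -
          ν * (4 * Real.pi ^ 2 * ∑ k, Torus.freqNormSq ((k : ↥(freqBall N : Finset (Fin 3 → ℤ))) : Fin 3 → ℤ) *
            ‖(galerkinPhaseFlow ν (fourierRestrict (freqBall N : Finset (Fin 3 → ℤ)) f) t x :
              ↥(freqBall N : Finset (Fin 3 → ℤ)) → EuclideanSpace ℂ (Fin 3)) k‖ ^ 2)) t := by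
  intro ν N f x t hν hf ht
  simp only [coe_galerkinPhaseFlow]
  -- the ball is symmetric, the force coefficients are real, the orbit is a global ODE solution
  have hS : ∀ k ∈ (freqBall N : Finset (Fin 3 → ℤ)), -k ∈ (freqBall N : Finset (Fin 3 → ℤ)) :=
    neg_mem_freqBall_of_mem
  have hg : IsRealCoeff (fourierRestrict (freqBall N : Finset (Fin 3 → ℤ)) f) :=
    isRealCoeff_mFourierCoeff (hf.integrable one_le_two)
  have hα := isGalerkinODESolution_galerkinCoeffFlow hν hS hg x.2
  have hmem := hα.mem t
  -- the energy identity in differential form (field quantities), two-sided at `t > 0`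
  have h1 := hasDerivWithinAt_univ.1
    (hasDerivWithinAt_energy ν hS ((hα.hasDerivAt ht).hasDerivWithinAt (s := Set.univ)) hmem hg)
  have h2 := h1.const_mul (2⁻¹ : ℝ)
  -- dictionary: work and enstrophy of the real trigonometric polynomials as coefficient sums
  have hP : ∫ y, ⟪realTrigPoly (freqBall N : Finset (Fin 3 → ℤ))
        (coeffExt (freqBall N : Finset (Fin 3 → ℤ))
          (fourierRestrict (freqBall N : Finset (Fin 3 → ℤ)) f)) y,
      realTrigPoly (freqBall N : Finset (Fin 3 → ℤ)) (coeffExt (freqBall N : Finset (Fin 3 → ℤ))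
        (galerkinCoeffFlow ν (fourierRestrict (freqBall N : Finset (Fin 3 → ℤ)) f) t
          (x : ↥(freqBall N : Finset (Fin 3 → ℤ)) → EuclideanSpace ℂ (Fin 3)))) y⟫_ℝ =
      ∑ k, (inner ℂ (fourierRestrict (freqBall N : Finset (Fin 3 → ℤ)) f k)
        (galerkinCoeffFlow ν (fourierRestrict (freqBall N : Finset (Fin 3 → ℤ)) f) t
          (x : ↥(freqBall N : Finset (Fin 3 → ℤ)) → EuclideanSpace ℂ (Fin 3)) k)).re := by
    rw [integral_inner_realTrigPoly_realTrigPoly hS (hg.isConjSymm_coeffExt hS)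
      (hmem.1.isConjSymm_coeffExt hS), ← Finset.sum_coe_sort]
    exact Finset.sum_congr rfl fun k _ => by rw [coeffExt_coe, coeffExt_coe]
  have hZ := toReal_eGradNormSq_realTrigPoly hS (hmem.1.isConjSymm_coeffExt hS)
  rw [sum_coeffExt (fun k v => freqNormSq k * ‖v‖ ^ 2)] at hZ
  rw [hP, hZ] at h2
  refine h2.congr_deriv ?_
  ring

end Summit.AnomalousDissipation.AnomalousDissipation.Theorems.UniformGalerkinTrap.Sketch
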